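import Literature.IUT.HodgeArakelov.RealifiedPrimeStripSplitComponent
import HarnessLib

/-!
# [IUTchII] Def 4.9 (vi)–(vii): the print-level record types of `F^{⊢▶×μ}`- and `F^{⊢×μ}`-prime-strips are INHABITED
# (NV-L6 wave, §F v1.18p; abc-iut cell, layer L6, seat abc-iut-w4-d028; PROOF-ONLY — no def / instance / structure)

S. Mochizuki, *Inter-universal Teichmüller theory II*, kurims Dec-2020 manuscript, Def 4.9 (vi)–(vii) pp. 157–158
(«we define an `F^{⊢□}`-prime-strip to be a collection of data `*F^{⊢□} = {*F^{⊢□}_v}_{v ∈ V}` such that for each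
`v ∈ V`, `*F^{⊢□}_v` is a collection of data that is isomorphic to `‡F^{⊢□}_v`»). [claim: Mochizuki2012, status:
disputed] — nothing here asserts a disputed claim or takes a side on [IUTchIII] Cor 3.12; a witness certifies
CONSISTENCY of a typed interface, not correctness of anything.

abc-iut-w5-d114's INHABITATION CENSUS v3 (§A) lists abc-iut-L6-t2's record types `FSplitTriMuPrimeStrip` ([IUTchII]
Def 4.9 (vii), print-level split morphisms; `KummerPrimeStripSplitCategories`) and `FTimesMuPrimeStrip` (Def 4.9
(vi)–(vii); `KummerPrimeStripCategories`) — and the field-only record `FTriMuPrimeStrip` they wrap — with ZERO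
producers in the kernel. Since abc-iut-w5-d087's `FVdashSplitTriMuPrimeStrip.Witness.nonempty`
(`RealifiedPrimeStripSplitComponent`, p416833) an `F^{⊩▶×μ}`-prime-strip EXISTS over one bad place; its images under
abc-iut-L6-t2's «underlying `F^{⊢▶×μ}`-prime-strip» functor `toSplitStripFunctor` (Def 4.9 (viii)) and «passing to
`F^{⊢×μ}`» functor `FSplitTriMuPrimeStrip.toTimesMuFunctor` (Def 4.9 (vi)–(vii)) inhabit the two record types. This
file records exactly that, as theorems whose statements CONCLUDE in the record types (so the census sees them).

HONEST LABEL — `nonempty_degenerate`: the witness has ONE place (bad), the GENUINE monoid `ℤ_[p] ∖ {0}` with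
`ρ = ord_p` and generator `p`, but a TRIVIAL Galois group `G = Unit` with tautological `×`/`×μ`-Kummer structures and
splitting `p^ℕ` (p416833 §1): degenerate on the Galois side, not a model of print's `‡F_v` over `G_v`. Every `p`, `l`.
-/

namespace Literature.IUT.HodgeArakelov

open CategoryTheory

/-- **IUTchII:Def4.9(vii)** (kurims p.158) NON-VACUITY (degenerate on the Galois side: `G = Unit`; genuine monoid
`ℤ_[p] ∖ {0}`, one bad place): the print-level groupoid of `F^{⊢▶×μ}`-prime-strips `FSplitTriMuPrimeStrip` is
INHABITED — by the underlying `F^{⊢▶×μ}`-prime-strip (abc-iut-L6-t2's `toSplitStripFunctor`) of abc-iut-w5-d087's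
witness `F^{⊩▶×μ}`-prime-strip (p416833). [claim: Mochizuki2012, status: disputed] -/
theorem FSplitTriMuPrimeStrip.nonempty_degenerate (p : ℕ) [Fact p.Prime] (l : ℕ) :
    ∃ X : ∀ _ : Unit, GroupTheoreticUnits.{0, 0} Unit,
      Nonempty (FSplitTriMuPrimeStrip.{0, 0, 0} (FVdashSplitTriMuPrimeStrip.Witness.badOnly l) (fun _ => Unit) X) := by
  obtain ⟨X, ⟨S⟩⟩ := FVdashSplitTriMuPrimeStrip.Witness.nonempty p l
  exact ⟨X, ⟨FVdashSplitTriMuPrimeStrip.toSplitStripFunctor.obj S⟩⟩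

/-- **IUTchII:Def4.9(vii)** (kurims p.157) NON-VACUITY (degenerate on the Galois side, as above): the print-level groupoid
of `F^{⊢×μ}`-prime-strips `FTimesMuPrimeStrip` is INHABITED — by «passing to `F^{⊢×μ}`» (abc-iut-L6-t2's
`FSplitTriMuPrimeStrip.toTimesMuFunctor`) from the previous witness. [claim: Mochizuki2012, status: disputed] -/
theorem FTimesMuPrimeStrip.nonempty_degenerate (p : ℕ) [Fact p.Prime] (l : ℕ) :
    ∃ X : ∀ _ : Unit, GroupTheoreticUnits.{0, 0} Unit,
      Nonempty (FTimesMuPrimeStrip.{0, 0, 0} (FVdashSplitTriMuPrimeStrip.Witness.badOnly l) (fun _ => Unit) X) := by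
  obtain ⟨X, ⟨S⟩⟩ := FVdashSplitTriMuPrimeStrip.Witness.nonempty p l
  exact ⟨X, ⟨FSplitTriMuPrimeStrip.toTimesMuFunctor.obj (FVdashSplitTriMuPrimeStrip.toSplitStripFunctor.obj S)⟩⟩

/-- **IUTchII:Def4.9(vi)** (kurims p.157) NON-VACUITY of the field-only record `FTriMuPrimeStrip` (the `V`-indexed
collection of Def 4.9 (vi) local data wrapped by both groupoids above; census: «field of 4 other structures only»):
inhabited by the local data of the same witness. [claim: Mochizuki2012, status: disputed] -/
theorem FTriMuPrimeStrip.nonempty_degenerate (p : ℕ) [Fact p.Prime] (l : ℕ) :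
    ∃ X : ∀ _ : Unit, GroupTheoreticUnits.{0, 0} Unit,
      Nonempty (FTriMuPrimeStrip.{0, 0, 0} (FVdashSplitTriMuPrimeStrip.Witness.badOnly l) (fun _ => Unit) X) := by
  obtain ⟨X, ⟨S⟩⟩ := FVdashSplitTriMuPrimeStrip.Witness.nonempty p l
  exact ⟨X, ⟨(FVdashSplitTriMuPrimeStrip.toSplitStripFunctor.obj S).data⟩⟩

/-- **IUTchII:Def4.9(vii)** (kurims p.158) CLOSED INSTANCE (no free parameters, for the census): at `p = 2`, `l = 7`
the three record types are inhabited. [claim: Mochizuki2012, status: disputed] -/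
theorem FSplitTriMuPrimeStrip.nonempty_degenerate_two_seven :
    ∃ X : ∀ _ : Unit, GroupTheoreticUnits.{0, 0} Unit,
      Nonempty (FSplitTriMuPrimeStrip.{0, 0, 0} (FVdashSplitTriMuPrimeStrip.Witness.badOnly 7) (fun _ => Unit) X) ∧
      Nonempty (FTimesMuPrimeStrip.{0, 0, 0} (FVdashSplitTriMuPrimeStrip.Witness.badOnly 7) (fun _ => Unit) X) ∧
      Nonempty (FTriMuPrimeStrip.{0, 0, 0} (FVdashSplitTriMuPrimeStrip.Witness.badOnly 7) (fun _ => Unit) X) := by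
  haveI : Fact (Nat.Prime 2) := ⟨Nat.prime_two⟩
  obtain ⟨X, ⟨S⟩⟩ := FVdashSplitTriMuPrimeStrip.Witness.nonempty 2 7
  exact ⟨X, ⟨FVdashSplitTriMuPrimeStrip.toSplitStripFunctor.obj S⟩,
    ⟨FSplitTriMuPrimeStrip.toTimesMuFunctor.obj (FVdashSplitTriMuPrimeStrip.toSplitStripFunctor.obj S)⟩,
    ⟨(FVdashSplitTriMuPrimeStrip.toSplitStripFunctor.obj S).data⟩⟩

end Literature.IUT.HodgeArakelov
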